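import Summits.QuantumFields.YangMills.Theses.FradkinShenkerFlow
import Summits.QuantumFields.YangMills.Theorems.FiniteSusceptibilityWeakCoupling.Negative.BetaZeroClause
import Literature.MathematicalPhysics.QuantumFieldTheory.ConstructiveQFTWave0OddRPProofs
import Literature.MathematicalPhysics.QuantumFieldTheory.LatticeGaugeStaticPotentialProofs
import Literature.MathematicalPhysics.QuantumFieldTheory.LatticeGaugeProofs
import Literature.Probability.LatticeModels.SharpnessProofs
import Summits.QuantumFields.YangMills.Theorems.FradkinShenkerFlowFiniteSusceptibilityWeakCouplingOddTorusRP
import Summits.QuantumFields.YangMills.Theorems.FradkinShenkerFlowFiniteSusceptibilityWeakCouplingRPCauchySchwarz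
import Summits.QuantumFields.YangMills.Theorems.FradkinShenkerFlowFiniteSusceptibilityWeakCouplingMirrorDominationAxis0
import Summits.QuantumFields.YangMills.Theorems.FradkinShenkerFlowFiniteSusceptibilityWeakCouplingMirrorReduction
import Summits.QuantumFields.YangMills.Theorems.FradkinShenkerFlowFiniteSusceptibilityWeakCouplingShellSummation
import Summits.QuantumFields.YangMills.Theorems.FradkinShenkerFlowFiniteSusceptibilityWeakCouplingAxisIsotropy

/-!
# Line `sup-axis-reflection-transfer` — LEAD's working skeleton for crux `stmt-QuantumFields-9442`
(`Summit.QuantumFields.YangMills.Theses.FradkinShenkerFlow.FiniteSusceptibilityWeakCoupling`)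

**The RP funnel.** Four-axis reflection positivity of Wilson's measure on the ODD torus
`(ℤ/(2S+1))⁴` (tree: `wilsonExpectation_oddReflectionPositive`, `θ t = 1 - t`, `β ≥ 0`, every compact `G`),
transported to every axis `μ` and every link hyperplane `x_μ = p + ½` by the proved torus symmetries
(`wilsonMeasure_map_torusConfigShift`, `wilsonMeasure_map_configPerm`) — STUB 1 — makes
`(F, G) ↦ Cov(F∘Θ, G)` a positive semidefinite symmetric form on the half-space algebra; the discriminant
Cauchy–Schwarz with the mirror placed MIDWAY between `supp A` and `supp τ_x B` (direction `μ` with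
`|x_μ| = ‖x‖∞`) dominates `|Cov_S(A, τ_x B)|` by axis covariances of finitely many fixed species pairs
(`A`, `B` and their mirror images) at lags within a bounded window of `‖x‖∞`, the transverse part of `x`
dropping out by translation invariance — STUB 2, which the lead (prover-line-stmt-QuantumFields-9442-0) has RESHAPED
into STUB 2a (centred RP Cauchy–Schwarz in every plane), STUB 2b (time-axis, positive-orientation domination)
and STUB 2c (hyperoctahedral reduction of every translate to that case). The `d = 4` shell count
`#{‖x‖∞ = n} ≤ 8(2n+1)³` turns pointwise domination + cubic axis moments into a volume-uniform `ℓ¹` bound —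
STUB 3; axis permutations of species reduce all four axes to the Euclidean-time axis — STUB 4; and the one
open input is the TRANSFER TARGET `C⁺` = time-axis cubic-moment summability at weak coupling for simple `G`
— STUB 5 (`stub_axialCubicMoment`, open-problem-sized, strictly weaker than every exponential
time-clustering sibling leg: see `axialCubicMoment_of_timeClustering`, PROVED below, which makes
"sibling ⇒ 9442" a kernel-checked chain through this file).

`FiniteSusceptibilityWeakCoupling_of` composes the seven stubs into the crux BY NAME (no `sorry` outside
the seven `stub_*`, no hypotheses). Stubs 1, 2a, 2b, 2c, 3, 4 hold for EVERY compact `G` and every `β ≥ 0` (resp. every `β`); simplicity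
and `β ≥ β₀` enter only through STUB 5 — honouring `Disproof.lean`'s
`withoutSimple_false_of_u1TorusPlaquetteNonSummable` (for `U(1)₄` STUB 5 fails, logarithmically, through the
C-odd plaquette `sin θ_P`, and so does the crux) and `fsClause_zero` (`β = 0`: all axis moments vanish beyond
the support diameter).

Layout: §0 named statements (short names) · §1 the registered stubs (signatures verbatim, `let`-free, fully
qualified, tree declarations only, so that a Theorems-side `propose --supports stmt-QuantumFields-9442` proof can
restate them textually) · §2 consistency (`named = stub`, definitional) + name-keyed aliases · §3 proved glue ·
§4 the composition · §5 the sibling attachment (proved).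
-/

noncomputable section

open MeasureTheory ProbabilityTheory
open scoped BigOperators
open Literature.MathematicalPhysics.QuantumFieldTheory hiding Site ZdEdge
open Literature.MathematicalPhysics.QuantumLattice
open Literature.Probability.LatticeModels hiding configShift configShift_apply

namespace Summit.QuantumFields.YangMills.Cruxes.FiniteSusceptibilityWeakCoupling.SupAxisReflectionTransfer

/-! ## §0 The statements (short names) -/

/-- STUB 1 statement — **odd-torus reflection positivity in every axis direction and every link
hyperplane** (real form). For `L = 2S+1 ≥ 3`, `β ≥ 0`, continuous `ρ`, a permutation `π` of the axes and a
torus translation `v`, let `Φ = τ_v ∘ π_*` (`torusConfigShift v ∘ configPerm π`) and `Θ = Φ ∘ Θ₀ ∘ Φ⁻¹` the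
transported time reflection (`Θ₀ = GaugeConfig.timeReflect`, `θ t = 1 - t`): for every bounded measurable
real `F` depending only on the links `e` with `Φ⁻¹`-label `(sitePerm π⁻¹ (e.1 - v), π⁻¹ e.2)` in the tree's
positive half `oPosEdges ∪ oSharedEdges`, `∫ F(ΘU) F(U) dμ_{β,S} ≥ 0`. -/
def OddTorusRPAllPlanes : Prop :=
  ∀ (G : Type) [Group G] [TopologicalSpace G] [IsTopologicalGroup G] [CompactSpace G]
    [MeasurableSpace G] [BorelSpace G] (N : ℕ) (ρ : G →* Matrix (Fin N) (Fin N) ℂ), Continuous ρ →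
    ∀ (β : ℝ), 0 ≤ β → ∀ (S : ℕ), 1 ≤ S →
    ∀ (π : Equiv.Perm (Fin 4)) (v : Literature.MathematicalPhysics.QuantumFieldTheory.Site 4 (2 * S + 1))
      (F : GaugeConfig 4 (2 * S + 1) G → ℝ), Measurable F → (∃ C : ℝ, ∀ U, |F U| ≤ C) →
      DependsOn F {e : Edge 4 (2 * S + 1) |
        WilsonOddRP.IsOPosEdge (sitePerm π.symm (e.1 - v), π.symm e.2) ∨
          WilsonOddRP.IsOSharedEdge (sitePerm π.symm (e.1 - v), π.symm e.2)} →
      0 ≤ ∫ U, F (torusConfigShift v (configPerm π (GaugeConfig.timeReflect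
              (configPerm π.symm (torusConfigShift (-v) U))))) * F U
            ∂(wilsonMeasure (d := 4) (L := 2 * S + 1) ρ β)

/-- STUB 2 conclusion — **mirror domination**: at `β ≥ 0`, for every pair of species there are finitely many
species pairs `(Pᵢ, Qᵢ)` (the pair and its axis mirror images), a constant `c ≥ 0`, a lag window `w` and a
threshold `n₀` such that on every torus `2S+1` and for every `x ∈ box 4 S` with `‖x‖∞ ≥ n₀`,
`|Cov_S(A, τ_x B)| ≤ c · Σ_{j ≤ S, |j - ‖x‖∞| ≤ w} Σᵢ Σ_μ |Cov_S(Pᵢ, τ_{j e_μ} Qᵢ)|`. -/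
def MirrorDomination : Prop :=
  ∀ (G : Type) [Group G] [TopologicalSpace G] [IsTopologicalGroup G] [CompactSpace G]
    [MeasurableSpace G] [BorelSpace G] (r : LatticeRep G) (β : ℝ), 0 ≤ β → ∀ A B : YMSpecies G,
    ∃ (k : ℕ) (P Q : Fin k → YMSpecies G) (c : ℝ) (w n₀ : ℕ), 0 ≤ c ∧ ∀ S : ℕ,
      ∀ x ∈ box 4 S, n₀ ≤ Site.supNorm x →
        |cov[fun U => A.F (torusLift (2 * S + 1) U),
            fun U => B.F (configShift (-x) (torusLift (2 * S + 1) U));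
            wilsonMeasure (d := 4) (L := 2 * S + 1) r.ρ β]| ≤
          c * ∑ j ∈ (Finset.range (S + 1)).filter
                (fun j => Site.supNorm x ≤ j + w ∧ j ≤ Site.supNorm x + w),
              ∑ i : Fin k, ∑ μ : Fin 4,
                |cov[fun U => (P i).F (torusLift (2 * S + 1) U),
                    fun U => (Q i).F (configShift (-(Pi.single μ (j : ℤ))) (torusLift (2 * S + 1) U));
                    wilsonMeasure (d := 4) (L := 2 * S + 1) r.ρ β]|

/-- STUB 2a statement — **centred reflection positivity + Cauchy–Schwarz in every plane** (lead's reshape of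
the planner's single lever stub): for the transported reflection `Θ = Φ ∘ Θ₀ ∘ Φ⁻¹` of STUB 1 (plane `(π, v)`)
and two bounded measurable real `F, G'` depending only on the transported positive half, the centred form
`(F, G') ↦ Cov(F∘Θ, G')` is positive semidefinite and satisfies the discriminant inequality:
`0 ≤ Cov(F∘Θ, F)`, `0 ≤ Cov(G'∘Θ, G')`, `Cov(F∘Θ, G')² ≤ Cov(F∘Θ, F) · Cov(G'∘Θ, G')`. From STUB 1 by centring
(`Θ` preserves `wilsonMeasure`, so `E[F∘Θ] = E[F]`, and constants depend on nothing), symmetry of the form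
(`Θ` is a measure-preserving involution) and the discriminant of `t ↦ Cov((F+tG')∘Θ, F+tG') ≥ 0`. -/
def OddTorusRPCauchySchwarz : Prop :=
  ∀ (G : Type) [Group G] [TopologicalSpace G] [IsTopologicalGroup G] [CompactSpace G]
    [MeasurableSpace G] [BorelSpace G] (N : ℕ) (ρ : G →* Matrix (Fin N) (Fin N) ℂ), Continuous ρ →
    ∀ (β : ℝ), 0 ≤ β → ∀ (S : ℕ), 1 ≤ S →
    ∀ (π : Equiv.Perm (Fin 4)) (v : Literature.MathematicalPhysics.QuantumFieldTheory.Site 4 (2 * S + 1))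
      (F G' : GaugeConfig 4 (2 * S + 1) G → ℝ), Measurable F → Measurable G' →
      (∃ C : ℝ, ∀ U, |F U| ≤ C) → (∃ C : ℝ, ∀ U, |G' U| ≤ C) →
      DependsOn F {e : Edge 4 (2 * S + 1) |
        WilsonOddRP.IsOPosEdge (sitePerm π.symm (e.1 - v), π.symm e.2) ∨
          WilsonOddRP.IsOSharedEdge (sitePerm π.symm (e.1 - v), π.symm e.2)} →
      DependsOn G' {e : Edge 4 (2 * S + 1) |
        WilsonOddRP.IsOPosEdge (sitePerm π.symm (e.1 - v), π.symm e.2) ∨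
          WilsonOddRP.IsOSharedEdge (sitePerm π.symm (e.1 - v), π.symm e.2)} →
      0 ≤ cov[fun U => F (torusConfigShift v (configPerm π (GaugeConfig.timeReflect
              (configPerm π.symm (torusConfigShift (-v) U))))), F;
            wilsonMeasure (d := 4) (L := 2 * S + 1) ρ β] ∧
      0 ≤ cov[fun U => G' (torusConfigShift v (configPerm π (GaugeConfig.timeReflect
              (configPerm π.symm (torusConfigShift (-v) U))))), G';
            wilsonMeasure (d := 4) (L := 2 * S + 1) ρ β] ∧
      (cov[fun U => F (torusConfigShift v (configPerm π (GaugeConfig.timeReflect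
              (configPerm π.symm (torusConfigShift (-v) U))))), G';
            wilsonMeasure (d := 4) (L := 2 * S + 1) ρ β]) ^ 2 ≤
        cov[fun U => F (torusConfigShift v (configPerm π (GaugeConfig.timeReflect
              (configPerm π.symm (torusConfigShift (-v) U))))), F;
            wilsonMeasure (d := 4) (L := 2 * S + 1) ρ β] *
        cov[fun U => G' (torusConfigShift v (configPerm π (GaugeConfig.timeReflect
              (configPerm π.symm (torusConfigShift (-v) U))))), G';
            wilsonMeasure (d := 4) (L := 2 * S + 1) ρ β]

/-- STUB 2b conclusion — **mirror domination along the time axis, positive orientation** (lead's reshape): as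
`MirrorDomination`, but only for translates `x` whose sup-norm is attained by the TIME coordinate with positive
sign (`x 0 = ‖x‖∞`), and with axis-`0` covariances only on the right. -/
def MirrorDominationAxis0 : Prop :=
  ∀ (G : Type) [Group G] [TopologicalSpace G] [IsTopologicalGroup G] [CompactSpace G]
    [MeasurableSpace G] [BorelSpace G] (r : LatticeRep G) (β : ℝ), 0 ≤ β → ∀ A B : YMSpecies G,
    ∃ (k : ℕ) (P Q : Fin k → YMSpecies G) (c : ℝ) (w n₀ : ℕ), 0 ≤ c ∧ ∀ S : ℕ,
      ∀ x ∈ box 4 S, n₀ ≤ Site.supNorm x → x 0 = (Site.supNorm x : ℤ) →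
        |cov[fun U => A.F (torusLift (2 * S + 1) U),
            fun U => B.F (configShift (-x) (torusLift (2 * S + 1) U));
            wilsonMeasure (d := 4) (L := 2 * S + 1) r.ρ β]| ≤
          c * ∑ j ∈ (Finset.range (S + 1)).filter
                (fun j => Site.supNorm x ≤ j + w ∧ j ≤ Site.supNorm x + w),
              ∑ i : Fin k,
                |cov[fun U => (P i).F (torusLift (2 * S + 1) U),
                    fun U => (Q i).F (configShift (-(Pi.single 0 (j : ℤ))) (torusLift (2 * S + 1) U));
                    wilsonMeasure (d := 4) (L := 2 * S + 1) r.ρ β]|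

/-- STUB 3 statement — **shell summation in `d = 4`**: pointwise domination by a lag window of a sequence
with bounded cubic moment, plus a uniform bound on the first `n₀` shells, gives a bound on the `ℓ¹` norm over
`box 4 S` that does not depend on `S` (explicitly `C = (2n₀+1)⁴|K| + 128 (w+1)⁴ |c| |M|` works:
`#{x : ‖x‖∞ = n} ≤ 8(2n+1)³`, tree `card_sphere_succ_le`). -/
def ShellSummation : Prop :=
  ∀ (n₀ w : ℕ) (K c M : ℝ), ∃ C : ℝ, ∀ (S : ℕ) (f : Literature.Probability.LatticeModels.Site 4 → ℝ)
    (g : ℕ → ℝ), 0 ≤ c → (∀ x ∈ box 4 S, |f x| ≤ K) → (∀ j, 0 ≤ g j) →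
    ∑ j ∈ Finset.range (S + 1), ((j : ℝ) + 1) ^ 3 * g j ≤ M →
    (∀ x ∈ box 4 S, n₀ ≤ Site.supNorm x →
      |f x| ≤ c * ∑ j ∈ (Finset.range (S + 1)).filter
          (fun j => Site.supNorm x ≤ j + w ∧ j ≤ Site.supNorm x + w), g j) →
    ∑ x ∈ box 4 S, |f x| ≤ C

/-- STUB 4 statement — **axis isotropy**: all-pairs cubic axis moments along the Euclidean-time axis `0`
give all-pairs cubic axis moments along every axis (axis permutations `configPermZd` act on species and leave
the torus Wilson state invariant: tree `wilsonMeasure_map_configPerm`, `toTorusObservable_comp_configPermZd`). -/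
def AxisIsotropy : Prop :=
  ∀ (G : Type) [Group G] [TopologicalSpace G] [IsTopologicalGroup G] [CompactSpace G]
    [MeasurableSpace G] [BorelSpace G] (r : LatticeRep G) (β : ℝ),
    (∀ A B : YMSpecies G, ∃ M : ℝ, ∀ S : ℕ,
      ∑ n ∈ Finset.range (S + 1), ((n : ℝ) + 1) ^ 3 *
        |cov[fun U => A.F (torusLift (2 * S + 1) U),
            fun U => B.F (configShift (-(Pi.single 0 (n : ℤ))) (torusLift (2 * S + 1) U));
            wilsonMeasure (d := 4) (L := 2 * S + 1) r.ρ β]| ≤ M) →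
    ∀ (μ : Fin 4) (A B : YMSpecies G), ∃ M : ℝ, ∀ S : ℕ,
      ∑ n ∈ Finset.range (S + 1), ((n : ℝ) + 1) ^ 3 *
        |cov[fun U => A.F (torusLift (2 * S + 1) U),
            fun U => B.F (configShift (-(Pi.single μ (n : ℤ))) (torusLift (2 * S + 1) U));
            wilsonMeasure (d := 4) (L := 2 * S + 1) r.ρ β]| ≤ M

/-- STUB 5 statement — **the transfer target `C⁺` (time-axis cubic moment at weak coupling)**: for compact
simple `G` and faithful unitary `r` there is `β₀` such that for `β ≥ β₀` every pair of species has
`Σ_{n ≤ S} (n+1)³ |Cov_S(A, τ_{n e₀} B)|` bounded uniformly in `S`. OPEN (the imported infrared problem in its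
weakest sufficient one-dimensional form); implied by every exponential time-clustering leg (§5). -/
def AxialCubicMoment : Prop :=
  ∀ (G : Type) [Group G] [TopologicalSpace G] [IsTopologicalGroup G] [CompactSpace G]
    [MeasurableSpace G] [BorelSpace G], IsCompactSimpleLieGroup G → ∀ (r : LatticeRep G),
    ∃ β₀ : ℝ, ∀ β : ℝ, β₀ ≤ β → ∀ A B : YMSpecies G, ∃ M : ℝ, ∀ S : ℕ,
      ∑ n ∈ Finset.range (S + 1), ((n : ℝ) + 1) ^ 3 *
        |cov[fun U => A.F (torusLift (2 * S + 1) U),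
            fun U => B.F (configShift (-(Pi.single 0 (n : ℤ))) (torusLift (2 * S + 1) U));
            wilsonMeasure (d := 4) (L := 2 * S + 1) r.ρ β]| ≤ M

/-! ## §1 The registered stubs (`sorry` lives only here) -/

/-- **STUB 1 · `stub_oddTorusRP`** (M, provable now) — transport of the PROVED odd-torus reflection positivity
`wilsonExpectation_oddReflectionPositive` (axis `0`, `θ t = 1 - t`, `L` odd `≥ 3`, `β ≥ 0`) through the two
measure-preserving torus symmetries `configPerm π` (`wilsonMeasure_map_configPerm`) and `torusConfigShift v`
(`wilsonMeasure_map_torusConfigShift`): with `Φ U = torusConfigShift v (configPerm π U)`,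
`(Φ U) e = U (sitePerm π⁻¹ (e.1 - v), π⁻¹ e.2)`, the function `F ∘ Φ` depends on `oPosEdges ∪ oSharedEdges`,
apply the tree theorem to the complexification of `F ∘ Φ` and change variables `U' = Φ U`
(`integral_map_equiv`); real part / `Complex.ofReal` bookkeeping. -/
theorem stub_oddTorusRP : ∀ (G : Type) [Group G] [TopologicalSpace G] [IsTopologicalGroup G] [CompactSpace G] [MeasurableSpace G] [BorelSpace G] (N : ℕ) (ρ : G →* Matrix (Fin N) (Fin N) ℂ), Continuous ρ → ∀ (β : ℝ), 0 ≤ β → ∀ (S : ℕ), 1 ≤ S → ∀ (π : Equiv.Perm (Fin 4)) (v : Literature.MathematicalPhysics.QuantumFieldTheory.Site 4 (2 * S + 1)) (F : Literature.MathematicalPhysics.QuantumFieldTheory.GaugeConfig 4 (2 * S + 1) G → ℝ), Measurable F → (∃ C : ℝ, ∀ U, |F U| ≤ C) → DependsOn F {e : Literature.MathematicalPhysics.QuantumFieldTheory.Edge 4 (2 * S + 1) | Literature.MathematicalPhysics.QuantumFieldTheory.WilsonOddRP.IsOPosEdge (Literature.MathematicalPhysics.QuantumFieldTheory.sitePerm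 π.symm (e.1 - v), π.symm e.2) ∨ Literature.MathematicalPhysics.QuantumFieldTheory.WilsonOddRP.IsOSharedEdge (Literature.MathematicalPhysics.QuantumFieldTheory.sitePerm π.symm (e.1 - v), π.symm e.2)} → 0 ≤ ∫ U, F (Literature.MathematicalPhysics.QuantumFieldTheory.torusConfigShift v (Literature.MathematicalPhysics.QuantumFieldTheory.configPerm π (Literature.MathematicalPhysics.QuantumFieldTheory.GaugeConfig.timeReflect (Literature.MathematicalPhysics.QuantumFieldTheory.configPerm π.symm (Literature.MathematicalPhysics.QuantumFieldTheory.torusConfigShift (-v) U))))) * F U ∂(Literature.MathematicalPhysics.QuantumFieldTheory.wilsonMeasure (d := 4) (L := 2 * S + 1) ρ β) :=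
  Summit.QuantumFields.YangMills.Theorems.FiniteSusceptibilityWeakCoupling.stub_oddTorusRP

/-- **STUB 2a · `stub_rpCauchySchwarz`** (M, provable now; lead's reshape of the planner's lever stub) — four-axis
odd-torus RP (STUB 1) ⇒ the CENTRED form is positive semidefinite with the discriminant Cauchy–Schwarz inequality.
With `Θ = Φ ∘ Θ₀ ∘ Φ⁻¹` (`Φ = torusConfigShift v ∘ configPerm π`): `Θ` is an involution preserving
`wilsonMeasure` (`wilsonMeasure_map_torusConfigShift`, `wilsonMeasure_map_configPerm`, and for `timeReflect`:
product Haar is preserved by `WilsonRP.measurePreserving_timeReflect` and the action by `WilsonRP.plaqRe_timeReflect`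
summed over the involution `WilsonRP.plaqReflect`), so `E[F∘Θ] = E[F]`; `F - E F` still depends on the positive half
(constants depend on nothing), hence STUB 1 gives `Cov(F∘Θ, F) = ∫ (F - EF)(ΘU) (F - EF)(U) dμ ≥ 0`; the form
`b(F, G') = Cov(F∘Θ, G')` is symmetric (change of variables `U ↦ ΘU`) and bilinear, so
`0 ≤ b(F + tG', F + tG')` for all real `t` yields `b(F, G')² ≤ b(F, F) b(G', G')`. -/
theorem stub_rpCauchySchwarz : (∀ (G : Type) [Group G] [TopologicalSpace G] [IsTopologicalGroup G] [CompactSpace G] [MeasurableSpace G] [BorelSpace G] (N : ℕ) (ρ : G →* Matrix (Fin N) (Fin N) ℂ), Continuous ρ → ∀ (β : ℝ), 0 ≤ β → ∀ (S : ℕ), 1 ≤ S → ∀ (π : Equiv.Perm (Fin 4)) (v : Literature.MathematicalPhysics.QuantumFieldTheory.Site 4 (2 * S + 1)) (F : Literature.MathematicalPhysics.QuantumFieldTheory.GaugeConfig 4 (2 * S + 1) G → ℝ), Measurable F → (∃ C : ℝ, ∀ U, |F U| ≤ C) → DependsOn F {e : Literature.MathematicalPhysics.QuantumFieldTheory.Edge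 4 (2 * S + 1) | Literature.MathematicalPhysics.QuantumFieldTheory.WilsonOddRP.IsOPosEdge (Literature.MathematicalPhysics.QuantumFieldTheory.sitePerm π.symm (e.1 - v), π.symm e.2) ∨ Literature.MathematicalPhysics.QuantumFieldTheory.WilsonOddRP.IsOSharedEdge (Literature.MathematicalPhysics.QuantumFieldTheory.sitePerm π.symm (e.1 - v), π.symm e.2)} → 0 ≤ ∫ U, F (Literature.MathematicalPhysics.QuantumFieldTheory.torusConfigShift v (Literature.MathematicalPhysics.QuantumFieldTheory.configPerm π (Literature.MathematicalPhysics.QuantumFieldTheory.GaugeConfig.timeReflect (Literature.MathematicalPhysics.QuantumFieldTheory.configPerm π.symm (Literature.MathematicalPhysics.QuantumFieldTheory.torusConfigShift (-v) U))))) * F U ∂(Literature.MathematicalPhysics.QuantumFieldTheory.wilsonMeasure (d := 4) (L := 2 * S + 1) ρ β)) → ∀ (G : Type) [Group G] [TopologicalSpace G] [IsTopologicalGroup G] [CompactSpace G] [MeasurableSpace G] [BorelSpace G] (N : ℕ) (ρ : G →* Matrix (Fin N) (Fin N) ℂ), Continuous ρ → ∀ (β : ℝ), 0 ≤ β → ∀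 (S : ℕ), 1 ≤ S → ∀ (π : Equiv.Perm (Fin 4)) (v : Literature.MathematicalPhysics.QuantumFieldTheory.Site 4 (2 * S + 1)) (F G' : Literature.MathematicalPhysics.QuantumFieldTheory.GaugeConfig 4 (2 * S + 1) G → ℝ), Measurable F → Measurable G' → (∃ C : ℝ, ∀ U, |F U| ≤ C) → (∃ C : ℝ, ∀ U, |G' U| ≤ C) → DependsOn F {e : Literature.MathematicalPhysics.QuantumFieldTheory.Edge 4 (2 * S + 1) | Literature.MathematicalPhysics.QuantumFieldTheory.WilsonOddRP.IsOPosEdge (Literature.MathematicalPhysics.QuantumFieldTheory.sitePerm π.symm (e.1 - v), π.symm e.2) ∨ Literature.MathematicalPhysics.QuantumFieldTheory.WilsonOddRP.IsOSharedEdge (Literature.MathematicalPhysics.QuantumFieldTheory.sitePerm π.symm (e.1 - v), π.symm e.2)} → DependsOn G' {e : Literature.MathematicalPhysics.QuantumFieldTheory.Edge 4 (2 * S + 1) | Literature.MathematicalPhysics.QuantumFieldTheory.WilsonOddRP.IsOPosEdge (Literature.MathematicalPhysics.QuantumFieldTheory.sitePerm π.symm (e.1 - v), π.symm e.2) ∨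 Literature.MathematicalPhysics.QuantumFieldTheory.WilsonOddRP.IsOSharedEdge (Literature.MathematicalPhysics.QuantumFieldTheory.sitePerm π.symm (e.1 - v), π.symm e.2)} → 0 ≤ ProbabilityTheory.covariance (fun U => F (Literature.MathematicalPhysics.QuantumFieldTheory.torusConfigShift v (Literature.MathematicalPhysics.QuantumFieldTheory.configPerm π (Literature.MathematicalPhysics.QuantumFieldTheory.GaugeConfig.timeReflect (Literature.MathematicalPhysics.QuantumFieldTheory.configPerm π.symm (Literature.MathematicalPhysics.QuantumFieldTheory.torusConfigShift (-v) U)))))) F (Literature.MathematicalPhysics.QuantumFieldTheory.wilsonMeasure (d := 4) (L := 2 * S + 1) ρ β) ∧ 0 ≤ ProbabilityTheory.covariance (fun U => G' (Literature.MathematicalPhysics.QuantumFieldTheory.torusConfigShift v (Literature.MathematicalPhysics.QuantumFieldTheory.configPerm π (Literature.MathematicalPhysics.QuantumFieldTheory.GaugeConfig.timeReflect (Literature.MathematicalPhysics.QuantumFieldTheory.configPerm π.symm (Literature.MathematicalPhysics.QuantumFieldTheory.torusConfigShift (-v) U)))))) G' (Literature.MathematicalPhysics.QuantumFieldTheory.wilsonMeasure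 (d := 4) (L := 2 * S + 1) ρ β) ∧ (ProbabilityTheory.covariance (fun U => F (Literature.MathematicalPhysics.QuantumFieldTheory.torusConfigShift v (Literature.MathematicalPhysics.QuantumFieldTheory.configPerm π (Literature.MathematicalPhysics.QuantumFieldTheory.GaugeConfig.timeReflect (Literature.MathematicalPhysics.QuantumFieldTheory.configPerm π.symm (Literature.MathematicalPhysics.QuantumFieldTheory.torusConfigShift (-v) U)))))) G' (Literature.MathematicalPhysics.QuantumFieldTheory.wilsonMeasure (d := 4) (L := 2 * S + 1) ρ β)) ^ 2 ≤ ProbabilityTheory.covariance (fun U => F (Literature.MathematicalPhysics.QuantumFieldTheory.torusConfigShift v (Literature.MathematicalPhysics.QuantumFieldTheory.configPerm π (Literature.MathematicalPhysics.QuantumFieldTheory.GaugeConfig.timeReflect (Literature.MathematicalPhysics.QuantumFieldTheory.configPerm π.symm (Literature.MathematicalPhysics.QuantumFieldTheory.torusConfigShift (-v) U)))))) F (Literature.MathematicalPhysics.QuantumFieldTheory.wilsonMeasure (d := 4) (L := 2 * S + 1) ρ β) * ProbabilityTheory.covariance (fun U => G' (Literature.MathematicalPhysics.QuantumFieldTheory.torusConfigShift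 v (Literature.MathematicalPhysics.QuantumFieldTheory.configPerm π (Literature.MathematicalPhysics.QuantumFieldTheory.GaugeConfig.timeReflect (Literature.MathematicalPhysics.QuantumFieldTheory.configPerm π.symm (Literature.MathematicalPhysics.QuantumFieldTheory.torusConfigShift (-v) U)))))) G' (Literature.MathematicalPhysics.QuantumFieldTheory.wilsonMeasure (d := 4) (L := 2 * S + 1) ρ β) :=
  Summit.QuantumFields.YangMills.Theorems.FiniteSusceptibilityWeakCoupling.stub_rpCauchySchwarz

/-- **STUB 2b · `stub_mirrorDominationAxis0`** (L⁻, provable now; THE LEVER, time axis, positive orientation) —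
centred RP Cauchy–Schwarz in every plane (STUB 2a, used with `π = 1`, `v = p e₀`) ⇒ mirror domination for translates
`x` with `x 0 = ‖x‖∞ = n ≥ n₀(A, B)`. Reflect through the link plane `p + ½`, `p = ⌊(a₂ + n + b₁)/2⌋` (`[a₁, a₂]`,
`[b₁, b₂]` the time extents of `supp A`, `supp B`, temporal links counting `+1` at the tip): for `n ≥ n₀` the block
`A∘lift` lies in the reflected half and `τ_x B∘lift` in the positive half `[p+1, p+S+1]` (this forces `S ≥ n ≥ n₀`);
`A∘lift = F_A∘Θ_p` with `F_A := A∘lift∘Θ_p` positive-half, so STUB 2a gives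
`Cov(A, τ_xB)² ≤ Cov(A∘lift, A∘lift∘Θ_p) · Cov(τ_xB∘lift∘Θ_p, τ_xB∘lift)`, both factors `≥ 0`, then AM–GM (`c = 1/2`).
Identification: `torusLift (Θ₀ U) = configShift e₀ (cfgReflect (torusLift U))` (`QCDTimeReflection.cfgReflect`,
`t ↦ -t`, temporal links inverted), `torusLift ∘ torusConfigShift (proj w) = configShift w ∘ torusLift`
(`toTorusObservable_comp_configShift`) and `cfgReflect ∘ configShift w = configShift (refl w) ∘ cfgReflect` give
`A∘lift∘Θ_p = A^R ∘ configShift (-(2p+1) e₀) ∘ lift` with the MIRROR SPECIES `A^R := ⟨A.F ∘ cfgReflect, …⟩`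
(a `YMSpecies`: cylinder on the reflected support, gauge invariant by `cfgReflect_gaugeTransformZd`, bounded,
measurable by `measurable_cfgReflect`), i.e. the first factor is `Cov_S(A, τ_((2p+1)e₀) A^R)`; likewise the second is
`Cov_S(B^R, τ_((2n-2p-1)e₀) B)` after translating by `-(x⊥ + (2p+1-n)e₀)` (`wilsonMeasure_map_torusConfigShift`
kills the transverse part). Lags `2p+1 ∈ [n+c-1, n+c]` and `2n-2p-1`, `c = a₂ + b₁`; a lag `j > S` is replaced by
`2S+1-j` and a negative lag by `-j`, swapping the pair (`Cov_S(X, τ_(-j) Y) = Cov_S(Y, τ_j X)`, periodicity of the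
lift), all within the window `w = |c| + 2` of `n` once `n₀ ≥ |c| + 2 +` (feasibility constants). Pairs
`P, Q = (A, A^R), (A^R, A), (B^R, B), (B, B^R)` (`k = 4`); empty supports give constant observables and zero
covariance. Group-blind, every compact `G`, every `β ≥ 0`. -/
theorem stub_mirrorDominationAxis0 : (∀ (G : Type) [Group G] [TopologicalSpace G] [IsTopologicalGroup G] [CompactSpace G] [MeasurableSpace G] [BorelSpace G] (N : ℕ) (ρ : G →* Matrix (Fin N) (Fin N) ℂ), Continuous ρ → ∀ (β : ℝ), 0 ≤ β → ∀ (S : ℕ), 1 ≤ S → ∀ (π : Equiv.Perm (Fin 4)) (v : Literature.MathematicalPhysics.QuantumFieldTheory.Site 4 (2 * S + 1)) (F G' : Literature.MathematicalPhysics.QuantumFieldTheory.GaugeConfig 4 (2 * S + 1) G → ℝ), Measurable F → Measurable G' → (∃ C : ℝ, ∀ U, |F U| ≤ C) → (∃ C : ℝ, ∀ U, |G' U| ≤ C) → DependsOn F {e : Literature.MathematicalPhysics.QuantumFieldTheory.Edge 4 (2 * S + 1) | Literature.MathematicalPhysics.QuantumFieldTheory.WilsonOddRP.IsOPosEdge (Literature.MathematicalPhysics.QuantumFieldTheory.sitePerm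 π.symm (e.1 - v), π.symm e.2) ∨ Literature.MathematicalPhysics.QuantumFieldTheory.WilsonOddRP.IsOSharedEdge (Literature.MathematicalPhysics.QuantumFieldTheory.sitePerm π.symm (e.1 - v), π.symm e.2)} → DependsOn G' {e : Literature.MathematicalPhysics.QuantumFieldTheory.Edge 4 (2 * S + 1) | Literature.MathematicalPhysics.QuantumFieldTheory.WilsonOddRP.IsOPosEdge (Literature.MathematicalPhysics.QuantumFieldTheory.sitePerm π.symm (e.1 - v), π.symm e.2) ∨ Literature.MathematicalPhysics.QuantumFieldTheory.WilsonOddRP.IsOSharedEdge (Literature.MathematicalPhysics.QuantumFieldTheory.sitePerm π.symm (e.1 - v), π.symm e.2)} → 0 ≤ ProbabilityTheory.covariance (fun U => F (Literature.MathematicalPhysics.QuantumFieldTheory.torusConfigShift v (Literature.MathematicalPhysics.QuantumFieldTheory.configPerm π (Literature.MathematicalPhysics.QuantumFieldTheory.GaugeConfig.timeReflect (Literature.MathematicalPhysics.QuantumFieldTheory.configPerm π.symm (Literature.MathematicalPhysics.QuantumFieldTheory.torusConfigShift (-v) U)))))) F (Literature.MathematicalPhysics.QuantumFieldTheory.wilsonMeasure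 (d := 4) (L := 2 * S + 1) ρ β) ∧ 0 ≤ ProbabilityTheory.covariance (fun U => G' (Literature.MathematicalPhysics.QuantumFieldTheory.torusConfigShift v (Literature.MathematicalPhysics.QuantumFieldTheory.configPerm π (Literature.MathematicalPhysics.QuantumFieldTheory.GaugeConfig.timeReflect (Literature.MathematicalPhysics.QuantumFieldTheory.configPerm π.symm (Literature.MathematicalPhysics.QuantumFieldTheory.torusConfigShift (-v) U)))))) G' (Literature.MathematicalPhysics.QuantumFieldTheory.wilsonMeasure (d := 4) (L := 2 * S + 1) ρ β) ∧ (ProbabilityTheory.covariance (fun U => F (Literature.MathematicalPhysics.QuantumFieldTheory.torusConfigShift v (Literature.MathematicalPhysics.QuantumFieldTheory.configPerm π (Literature.MathematicalPhysics.QuantumFieldTheory.GaugeConfig.timeReflect (Literature.MathematicalPhysics.QuantumFieldTheory.configPerm π.symm (Literature.MathematicalPhysics.QuantumFieldTheory.torusConfigShift (-v) U)))))) G' (Literature.MathematicalPhysics.QuantumFieldTheory.wilsonMeasure (d := 4) (L := 2 * S + 1) ρ β)) ^ 2 ≤ ProbabilityTheory.covariance (fun U => F (Literature.MathematicalPhysics.QuantumFieldTheory.torusConfigShift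 v (Literature.MathematicalPhysics.QuantumFieldTheory.configPerm π (Literature.MathematicalPhysics.QuantumFieldTheory.GaugeConfig.timeReflect (Literature.MathematicalPhysics.QuantumFieldTheory.configPerm π.symm (Literature.MathematicalPhysics.QuantumFieldTheory.torusConfigShift (-v) U)))))) F (Literature.MathematicalPhysics.QuantumFieldTheory.wilsonMeasure (d := 4) (L := 2 * S + 1) ρ β) * ProbabilityTheory.covariance (fun U => G' (Literature.MathematicalPhysics.QuantumFieldTheory.torusConfigShift v (Literature.MathematicalPhysics.QuantumFieldTheory.configPerm π (Literature.MathematicalPhysics.QuantumFieldTheory.GaugeConfig.timeReflect (Literature.MathematicalPhysics.QuantumFieldTheory.configPerm π.symm (Literature.MathematicalPhysics.QuantumFieldTheory.torusConfigShift (-v) U)))))) G' (Literature.MathematicalPhysics.QuantumFieldTheory.wilsonMeasure (d := 4) (L := 2 * S + 1) ρ β)) → ∀ (G : Type) [Group G] [TopologicalSpace G] [IsTopologicalGroup G] [CompactSpace G] [MeasurableSpace G] [BorelSpace G] (r : Literature.MathematicalPhysics.QuantumFieldTheory.LatticeRep G) (β : ℝ), 0 ≤ β → ∀ A B : Literature.MathematicalPhysics.QuantumFieldTheory.YMSpecies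 G, ∃ (k : ℕ) (P Q : Fin k → Literature.MathematicalPhysics.QuantumFieldTheory.YMSpecies G) (c : ℝ) (w n₀ : ℕ), 0 ≤ c ∧ ∀ S : ℕ, ∀ x ∈ Literature.Probability.LatticeModels.box 4 S, n₀ ≤ Literature.Probability.LatticeModels.Site.supNorm x → x 0 = (Literature.Probability.LatticeModels.Site.supNorm x : ℤ) → |ProbabilityTheory.covariance (fun U => A.F (Literature.MathematicalPhysics.QuantumLattice.torusLift (2 * S + 1) U)) (fun U => B.F (Literature.MathematicalPhysics.QuantumLattice.configShift (-x) (Literature.MathematicalPhysics.QuantumLattice.torusLift (2 * S + 1) U))) (Literature.MathematicalPhysics.QuantumFieldTheory.wilsonMeasure (d := 4) (L := 2 * S + 1) r.ρ β)| ≤ c * ∑ j ∈ (Finset.range (S + 1)).filter (fun j => Literature.Probability.LatticeModels.Site.supNorm x ≤ j + w ∧ j ≤ Literature.Probability.LatticeModels.Site.supNorm x + w), ∑ i : Fin k, |ProbabilityTheory.covariance (fun U => (P i).F (Literature.MathematicalPhysics.QuantumLattice.torusLift (2 * S + 1) U)) (fun U => (Q i).F (Literature.MathematicalPhysics.QuantumLattice.configShift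 (-(Pi.single 0 (j : ℤ))) (Literature.MathematicalPhysics.QuantumLattice.torusLift (2 * S + 1) U))) (Literature.MathematicalPhysics.QuantumFieldTheory.wilsonMeasure (d := 4) (L := 2 * S + 1) r.ρ β)| :=
  Summit.QuantumFields.YangMills.Theorems.FiniteSusceptibilityWeakCoupling.stub_mirrorDominationAxis0

/-- **STUB 2c · `stub_mirrorReduction`** (M, provable now; hyperoctahedral bookkeeping) — time-axis
positive-orientation domination (STUB 2b, for ALL species pairs) ⇒ `MirrorDomination` for every translate. For `x`
with `‖x‖∞ = n = |x_μ|`: if `x_μ = -n` first swap the pair, `Cov_S(A, τ_x B) = Cov_S(B, τ_(-x) A)` (symmetry of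
`cov` + torus translation invariance `wilsonMeasure_map_torusConfigShift` with `toTorusObservable_comp_configShift`);
then transport the axis with `π = Equiv.swap 0 μ`: `Cov_S(A, τ_y B) = Cov_S(A^π, τ_(π⁻¹y) B^π)` where
`A^π := ⟨A.F ∘ configPermZd π, supp.image …, IsCylinder.comp_configPermZd, …⟩` is again a `YMSpecies`
(gauge invariance: `configPermZd π (gaugeTransformZd g U) = gaugeTransformZd (g ∘ sitePermZd π.symm) (configPermZd π U)`;
measurable by `measurable_pi_lambda`), using `wilsonMeasure_map_configPerm r.continuous`,
`toTorusObservable_comp_configPermZd` and `configShift y ∘ configPermZd π = configPermZd π ∘ configShift (sitePermZd π.symm y)`;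
`(π⁻¹y) 0 = y μ = ‖y‖∞`, `π⁻¹y ∈ box 4 S`, `‖π⁻¹y‖∞ = ‖y‖∞`. Apply STUB 2b to the 8 transformed pairs
`(A^π, B^π)`, `(B^π, A^π)` (`μ < 4`), concatenate their lists (`finSigmaFinEquiv`, or pad to a common length —
extra non-negative terms are harmless since the right side sums `|Cov|` over all `i` and all four axes), take
`c = Σ c`, `w = max w`, `n₀ = max n₀`; the axis-`0` terms produced by STUB 2b are among the `μ = 0` summands of
`MirrorDomination`. -/
theorem stub_mirrorReduction : (∀ (G : Type) [Group G] [TopologicalSpace G] [IsTopologicalGroup G] [CompactSpace G] [MeasurableSpace G] [BorelSpace G] (r : Literature.MathematicalPhysics.QuantumFieldTheory.LatticeRep G) (β : ℝ), 0 ≤ β → ∀ A B : Literature.MathematicalPhysics.QuantumFieldTheory.YMSpecies G, ∃ (k : ℕ) (P Q : Fin k → Literature.MathematicalPhysics.QuantumFieldTheory.YMSpecies G) (c : ℝ) (w n₀ : ℕ), 0 ≤ c ∧ ∀ S : ℕ, ∀ x ∈ Literature.Probability.LatticeModels.box 4 S, n₀ ≤ Literature.Probability.LatticeModels.Site.supNorm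 x → x 0 = (Literature.Probability.LatticeModels.Site.supNorm x : ℤ) → |ProbabilityTheory.covariance (fun U => A.F (Literature.MathematicalPhysics.QuantumLattice.torusLift (2 * S + 1) U)) (fun U => B.F (Literature.MathematicalPhysics.QuantumLattice.configShift (-x) (Literature.MathematicalPhysics.QuantumLattice.torusLift (2 * S + 1) U))) (Literature.MathematicalPhysics.QuantumFieldTheory.wilsonMeasure (d := 4) (L := 2 * S + 1) r.ρ β)| ≤ c * ∑ j ∈ (Finset.range (S + 1)).filter (fun j => Literature.Probability.LatticeModels.Site.supNorm x ≤ j + w ∧ j ≤ Literature.Probability.LatticeModels.Site.supNorm x + w), ∑ i : Fin k, |ProbabilityTheory.covariance (fun U => (P i).F (Literature.MathematicalPhysics.QuantumLattice.torusLift (2 * S + 1) U)) (fun U => (Q i).F (Literature.MathematicalPhysics.QuantumLattice.configShift (-(Pi.single 0 (j : ℤ))) (Literature.MathematicalPhysics.QuantumLattice.torusLift (2 * S + 1) U))) (Literature.MathematicalPhysics.QuantumFieldTheory.wilsonMeasure (d := 4) (L := 2 * S + 1) r.ρ β)|) → ∀ (G : Type) [Group G] [TopologicalSpace G] [IsTopologicalGroup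 G] [CompactSpace G] [MeasurableSpace G] [BorelSpace G] (r : Literature.MathematicalPhysics.QuantumFieldTheory.LatticeRep G) (β : ℝ), 0 ≤ β → ∀ A B : Literature.MathematicalPhysics.QuantumFieldTheory.YMSpecies G, ∃ (k : ℕ) (P Q : Fin k → Literature.MathematicalPhysics.QuantumFieldTheory.YMSpecies G) (c : ℝ) (w n₀ : ℕ), 0 ≤ c ∧ ∀ S : ℕ, ∀ x ∈ Literature.Probability.LatticeModels.box 4 S, n₀ ≤ Literature.Probability.LatticeModels.Site.supNorm x → |ProbabilityTheory.covariance (fun U => A.F (Literature.MathematicalPhysics.QuantumLattice.torusLift (2 * S + 1) U)) (fun U => B.F (Literature.MathematicalPhysics.QuantumLattice.configShift (-x) (Literature.MathematicalPhysics.QuantumLattice.torusLift (2 * S + 1) U))) (Literature.MathematicalPhysics.QuantumFieldTheory.wilsonMeasure (d := 4) (L := 2 * S + 1) r.ρ β)| ≤ c * ∑ j ∈ (Finset.range (S + 1)).filter (fun j => Literature.Probability.LatticeModels.Site.supNorm x ≤ j + w ∧ j ≤ Literature.Probability.LatticeModels.Site.supNorm x + w), ∑ i : Fin k, ∑ μ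 : Fin 4, |ProbabilityTheory.covariance (fun U => (P i).F (Literature.MathematicalPhysics.QuantumLattice.torusLift (2 * S + 1) U)) (fun U => (Q i).F (Literature.MathematicalPhysics.QuantumLattice.configShift (-(Pi.single μ (j : ℤ))) (Literature.MathematicalPhysics.QuantumLattice.torusLift (2 * S + 1) U))) (Literature.MathematicalPhysics.QuantumFieldTheory.wilsonMeasure (d := 4) (L := 2 * S + 1) r.ρ β)| :=
  Summit.QuantumFields.YangMills.Theorems.FiniteSusceptibilityWeakCoupling.stub_mirrorReduction

/-- **STUB 3 · `stub_shellSummation`** (S–M, provable now; where `d = 4` enters) — split `box 4 S` into the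
shells `sphere 4 n` (`mem_box_iff_supNorm_le`, `sphere_succ_eq_sdiff`); shells `n < n₀` contribute at most
`#(box 4 (n₀ - 1)) · K ≤ (2n₀+1)⁴ |K|` (`card_box`; `K ≥ |f 0| ≥ 0`); on the others use the domination
hypothesis and exchange the sums: `Σ_j g j · #{x ∈ box 4 S : |‖x‖∞ - j| ≤ w} ≤ Σ_j g j · (2w+1) · 8 (2(j+w)+1)³`
(`card_sphere_succ_le`, `sphere 4 0 = {0}`) `≤ 128 (w+1)⁴ Σ_j (j+1)³ g j ≤ 128 (w+1)⁴ M`. So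
`C = (2n₀+1)⁴ |K| + 128 (w+1)⁴ |c| |M|` works. Pure `Finset` combinatorics over
`Literature.Probability.LatticeModels.{box, sphere, Site.supNorm}`. -/
theorem stub_shellSummation : ∀ (n₀ w : ℕ) (K c M : ℝ), ∃ C : ℝ, ∀ (S : ℕ) (f : Literature.Probability.LatticeModels.Site 4 → ℝ) (g : ℕ → ℝ), 0 ≤ c → (∀ x ∈ Literature.Probability.LatticeModels.box 4 S, |f x| ≤ K) → (∀ j, 0 ≤ g j) → ∑ j ∈ Finset.range (S + 1), ((j : ℝ) + 1) ^ 3 * g j ≤ M → (∀ x ∈ Literature.Probability.LatticeModels.box 4 S, n₀ ≤ Literature.Probability.LatticeModels.Site.supNorm x → |f x| ≤ c * ∑ j ∈ (Finset.range (S + 1)).filter (fun j => Literature.Probability.LatticeModels.Site.supNorm x ≤ j + w ∧ j ≤ Literature.Probability.LatticeModels.Site.supNorm x + w), g j) → ∑ x ∈ Literature.Probability.LatticeModels.box 4 S, |f x| ≤ C :=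
  Summit.QuantumFields.YangMills.Theorems.FiniteSusceptibilityWeakCoupling.stub_shellSummation

/-- **STUB 4 · `stub_axisIsotropy`** (M, provable now) — for `μ ≠ 0` let `π = Equiv.swap 0 μ`; the permuted
species `A ∘ configPermZd π`, `B ∘ configPermZd π` are again `YMSpecies` (cylinder: `IsCylinder.comp_configPermZd`;
gauge invariance: `configPermZd` intertwines `gaugeTransformZd g` with `gaugeTransformZd (g ∘ sitePermZd π⁻¹)`;
bounded; measurable: `continuous_configPermZd`), the periodic lift intertwines (`toTorusObservable_comp_configPermZd`),
`configPermZd π ∘ configShift (Pi.single 0 n) = configShift (Pi.single μ n) ∘ configPermZd π`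
(`sitePermZd_single`), and the torus state is invariant (`wilsonMeasure_map_configPerm`, `r.continuous`):
every axis-`μ` covariance of `(A, B)` is an axis-`0` covariance of the permuted pair, term by term. -/
theorem stub_axisIsotropy : ∀ (G : Type) [Group G] [TopologicalSpace G] [IsTopologicalGroup G] [CompactSpace G] [MeasurableSpace G] [BorelSpace G] (r : Literature.MathematicalPhysics.QuantumFieldTheory.LatticeRep G) (β : ℝ), (∀ A B : Literature.MathematicalPhysics.QuantumFieldTheory.YMSpecies G, ∃ M : ℝ, ∀ S : ℕ, ∑ n ∈ Finset.range (S + 1), ((n : ℝ) + 1) ^ 3 * |ProbabilityTheory.covariance (fun U => A.F (Literature.MathematicalPhysics.QuantumLattice.torusLift (2 * S + 1) U)) (fun U => B.F (Literature.MathematicalPhysics.QuantumLattice.configShift (-(Pi.single 0 (n : ℤ))) (Literature.MathematicalPhysics.QuantumLattice.torusLift (2 * S + 1) U))) (Literature.MathematicalPhysics.QuantumFieldTheory.wilsonMeasure (d := 4) (L := 2 * S + 1) r.ρ β)| ≤ M) → ∀ (μ : Fin 4) (A B : Literature.MathematicalPhysics.QuantumFieldTheory.YMSpecies G), ∃ M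 : ℝ, ∀ S : ℕ, ∑ n ∈ Finset.range (S + 1), ((n : ℝ) + 1) ^ 3 * |ProbabilityTheory.covariance (fun U => A.F (Literature.MathematicalPhysics.QuantumLattice.torusLift (2 * S + 1) U)) (fun U => B.F (Literature.MathematicalPhysics.QuantumLattice.configShift (-(Pi.single μ (n : ℤ))) (Literature.MathematicalPhysics.QuantumLattice.torusLift (2 * S + 1) U))) (Literature.MathematicalPhysics.QuantumFieldTheory.wilsonMeasure (d := 4) (L := 2 * S + 1) r.ρ β)| ≤ M :=
  Summit.QuantumFields.YangMills.Theorems.FiniteSusceptibilityWeakCoupling.stub_axisIsotropy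

/-- **STUB 5 · `stub_axialCubicMoment`** (OPEN — the transfer target `C⁺`; hardest) — time-axis cubic-moment
summability of all species pairs at weak coupling for compact simple `G`, uniformly in the odd torus. Strictly
weaker than exponential time clustering (§5: `axialCubicMoment_of_timeClustering`, proved), strictly stronger
than the crux only by the weight; expected TRUE for simple `G` (no gauge-invariant first chaos: `(𝔤*)^G = 0`,
free singlet exponent `8 > 4`) and FALSE for `U(1)₄` (`sin θ_P`, exponent `4`: `Σ (n+1)³ n⁻⁴ = ∞`), matching
`Disproof.lean` §2. Enemies: bulk coexistence accumulating at `β = ∞`; a gauge-invariant infrared field of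
dimension `≤ 2`. No engine is claimed here. -/
theorem stub_axialCubicMoment : ∀ (G : Type) [Group G] [TopologicalSpace G] [IsTopologicalGroup G] [CompactSpace G] [MeasurableSpace G] [BorelSpace G], Literature.MathematicalPhysics.QuantumFieldTheory.IsCompactSimpleLieGroup G → ∀ (r : Literature.MathematicalPhysics.QuantumFieldTheory.LatticeRep G), ∃ β₀ : ℝ, ∀ β : ℝ, β₀ ≤ β → ∀ A B : Literature.MathematicalPhysics.QuantumFieldTheory.YMSpecies G, ∃ M : ℝ, ∀ S : ℕ, ∑ n ∈ Finset.range (S + 1), ((n : ℝ) + 1) ^ 3 * |ProbabilityTheory.covariance (fun U => A.F (Literature.MathematicalPhysics.QuantumLattice.torusLift (2 * S + 1) U)) (fun U => B.F (Literature.MathematicalPhysics.QuantumLattice.configShift (-(Pi.single 0 (n : ℤ))) (Literature.MathematicalPhysics.QuantumLattice.torusLift (2 * S + 1) U))) (Literature.MathematicalPhysics.QuantumFieldTheory.wilsonMeasure (d := 4) (L := 2 * S + 1) r.ρ β)| ≤ M := by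
  sorry

/-! ## §2 Consistency (each named statement IS its registered stub, definitionally) and name-keyed aliases -/

/-- Consistency: STUB 1 is `OddTorusRPAllPlanes` (definitional). -/
theorem oddTorusRPAllPlanes_holds : OddTorusRPAllPlanes := stub_oddTorusRP
/-- Consistency: STUB 2a is `OddTorusRPAllPlanes → OddTorusRPCauchySchwarz` (definitional). -/
theorem oddTorusRPCauchySchwarz_holds : OddTorusRPCauchySchwarz := stub_rpCauchySchwarz stub_oddTorusRP
/-- Consistency: STUB 2b is `OddTorusRPCauchySchwarz → MirrorDominationAxis0` (definitional). -/
theorem mirrorDominationAxis0_holds : MirrorDominationAxis0 :=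
  stub_mirrorDominationAxis0 (stub_rpCauchySchwarz stub_oddTorusRP)
/-- Consistency: STUB 2c is `MirrorDominationAxis0 → MirrorDomination` (definitional). -/
theorem mirrorDomination_holds : MirrorDomination :=
  stub_mirrorReduction (stub_mirrorDominationAxis0 (stub_rpCauchySchwarz stub_oddTorusRP))
/-- Consistency: STUB 3 is `ShellSummation` (definitional). -/
theorem shellSummation_holds : ShellSummation := stub_shellSummation
/-- Consistency: STUB 4 is `AxisIsotropy` (definitional). -/
theorem axisIsotropy_holds : AxisIsotropy := stub_axisIsotropy
/-- Consistency: STUB 5 is `AxialCubicMoment` (definitional). -/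
theorem axialCubicMoment_holds : AxialCubicMoment := stub_axialCubicMoment

namespace Registered

/-- Alias of STUB 1's statement keyed by the registered stub name. -/
abbrev stub_oddTorusRP : Prop := OddTorusRPAllPlanes
/-- Alias of STUB 2a's statement keyed by the registered stub name. -/
abbrev stub_rpCauchySchwarz : Prop := OddTorusRPAllPlanes → OddTorusRPCauchySchwarz
/-- Alias of STUB 2b's statement keyed by the registered stub name. -/
abbrev stub_mirrorDominationAxis0 : Prop := OddTorusRPCauchySchwarz → MirrorDominationAxis0
/-- Alias of STUB 2c's statement keyed by the registered stub name. -/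
abbrev stub_mirrorReduction : Prop := MirrorDominationAxis0 → MirrorDomination
/-- Alias of STUB 3's statement keyed by the registered stub name. -/
abbrev stub_shellSummation : Prop := ShellSummation
/-- Alias of STUB 4's statement keyed by the registered stub name. -/
abbrev stub_axisIsotropy : Prop := AxisIsotropy
/-- Alias of STUB 5's statement keyed by the registered stub name. -/
abbrev stub_axialCubicMoment : Prop := AxialCubicMoment

end Registered

/-! ## §3 Proved glue: the inner clause at fixed `(G, r, β)` from mirror domination, shell summation and
all-axes cubic moments -/

section Glue

variable {G : Type} [Group G] [TopologicalSpace G] [IsTopologicalGroup G] [CompactSpace G]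
  [MeasurableSpace G] [BorelSpace G]

/-- **The funnel at fixed coupling.** Mirror domination for all pairs + the shell lemma + cubic axis moments
for all pairs along all axes ⇒ the crux's inner clause (finite susceptibility, uniformly in the torus) —
every compact `G`, every `β` for which the three inputs hold. -/
theorem susceptibility_of_domination_and_moments (r : LatticeRep G) (β : ℝ)
    (hMD : ∀ A B : YMSpecies G,
      ∃ (k : ℕ) (P Q : Fin k → YMSpecies G) (c : ℝ) (w n₀ : ℕ), 0 ≤ c ∧ ∀ S : ℕ,
        ∀ x ∈ box 4 S, n₀ ≤ Site.supNorm x →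
          |cov[fun U => A.F (torusLift (2 * S + 1) U),
              fun U => B.F (configShift (-x) (torusLift (2 * S + 1) U));
              wilsonMeasure (d := 4) (L := 2 * S + 1) r.ρ β]| ≤
            c * ∑ j ∈ (Finset.range (S + 1)).filter
                  (fun j => Site.supNorm x ≤ j + w ∧ j ≤ Site.supNorm x + w),
                ∑ i : Fin k, ∑ μ : Fin 4,
                  |cov[fun U => (P i).F (torusLift (2 * S + 1) U),
                      fun U => (Q i).F (configShift (-(Pi.single μ (j : ℤ))) (torusLift (2 * S + 1) U));
                      wilsonMeasure (d := 4) (L := 2 * S + 1) r.ρ β]|)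
    (hSh : ShellSummation)
    (hMom : ∀ (μ : Fin 4) (A B : YMSpecies G), ∃ M : ℝ, ∀ S : ℕ,
      ∑ n ∈ Finset.range (S + 1), ((n : ℝ) + 1) ^ 3 *
        |cov[fun U => A.F (torusLift (2 * S + 1) U),
            fun U => B.F (configShift (-(Pi.single μ (n : ℤ))) (torusLift (2 * S + 1) U));
            wilsonMeasure (d := 4) (L := 2 * S + 1) r.ρ β]| ≤ M) :
    ∀ A B : YMSpecies G, ∃ χ : ℝ, ∀ S : ℕ,
      ∑ x ∈ box 4 S, |cov[fun U => A.F (torusLift (2 * S + 1) U),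
          fun U => B.F (configShift (-x) (torusLift (2 * S + 1) U));
          wilsonMeasure (d := 4) (L := 2 * S + 1) r.ρ β]| ≤ χ := by
  intro A B
  obtain ⟨k, P, Q, c, w, n₀, hc, hdom⟩ := hMD A B
  obtain ⟨a, ha⟩ := A.bounded
  obtain ⟨b, hb⟩ := B.bounded
  choose Mf hMf using fun p : Fin k × Fin 4 => hMom p.2 (P p.1) (Q p.1)
  obtain ⟨C, hC⟩ := hSh n₀ w (4 * a * b) c (∑ p : Fin k × Fin 4, Mf p)
  refine ⟨C, fun S => ?_⟩
  haveI : IsProbabilityMeasure (wilsonMeasure (d := 4) (L := 2 * S + 1) r.ρ β) :=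
    isProbabilityMeasure_wilsonMeasure _ r.continuous β
  refine hC S
    (fun x => cov[fun U => A.F (torusLift (2 * S + 1) U),
        fun U => B.F (configShift (-x) (torusLift (2 * S + 1) U));
        wilsonMeasure (d := 4) (L := 2 * S + 1) r.ρ β])
    (fun j => ∑ i : Fin k, ∑ μ : Fin 4,
        |cov[fun U => (P i).F (torusLift (2 * S + 1) U),
            fun U => (Q i).F (configShift (-(Pi.single μ (j : ℤ))) (torusLift (2 * S + 1) U));
            wilsonMeasure (d := 4) (L := 2 * S + 1) r.ρ β]|)
    hc ?_ ?_ ?_ ?_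
  · intro x _
    exact Summit.QuantumFields.YangMills.Theorems.FiniteSusceptibilityWeakCoupling.Negative.abs_covariance_le_of_abs_le
      (fun U => ha _) (fun U => hb _)
  · intro j
    exact Finset.sum_nonneg fun i _ => Finset.sum_nonneg fun μ _ => abs_nonneg _
  · calc ∑ j ∈ Finset.range (S + 1), ((j : ℝ) + 1) ^ 3 * ∑ i : Fin k, ∑ μ : Fin 4,
            |cov[fun U => (P i).F (torusLift (2 * S + 1) U),
                fun U => (Q i).F (configShift (-(Pi.single μ (j : ℤ))) (torusLift (2 * S + 1) U));
                wilsonMeasure (d := 4) (L := 2 * S + 1) r.ρ β]|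
          = ∑ i : Fin k, ∑ μ : Fin 4, ∑ j ∈ Finset.range (S + 1), ((j : ℝ) + 1) ^ 3 *
              |cov[fun U => (P i).F (torusLift (2 * S + 1) U),
                  fun U => (Q i).F (configShift (-(Pi.single μ (j : ℤ))) (torusLift (2 * S + 1) U));
                  wilsonMeasure (d := 4) (L := 2 * S + 1) r.ρ β]| := by
            simp_rw [Finset.mul_sum]
            rw [Finset.sum_comm]
            refine Finset.sum_congr rfl fun i _ => ?_
            rw [Finset.sum_comm]
      _ ≤ ∑ i : Fin k, ∑ μ : Fin 4, Mf (i, μ) :=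
            Finset.sum_le_sum fun i _ => Finset.sum_le_sum fun μ _ => hMf (i, μ) S
      _ = ∑ p : Fin k × Fin 4, Mf p := (Fintype.sum_prod_type _).symm
  · intro x hx hn
    exact hdom S x hx hn

end Glue

/-! ## §4 The composition: the five stubs imply the crux, BY NAME -/

/-- `FiniteSusceptibilityWeakCoupling` from the seven stub STATEMENTS (pure logic; no `sorry`): STUB 5 supplies `β₀`
and the time-axis cubic moments at `β ≥ max β₀ 0`, STUB 4 spreads them to all axes, STUBS 1 → 2a → 2b → 2c (at
`β ≥ 0`) dominate every `|Cov_S(A, τ_x B)|` shell-wise, STUB 3 sums the shells uniformly in `S`. -/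
theorem finiteSusceptibilityWeakCoupling_of_stubs (h₁ : Registered.stub_oddTorusRP)
    (h₂a : Registered.stub_rpCauchySchwarz) (h₂b : Registered.stub_mirrorDominationAxis0)
    (h₂c : Registered.stub_mirrorReduction) (h₃ : Registered.stub_shellSummation)
    (h₄ : Registered.stub_axisIsotropy) (h₅ : Registered.stub_axialCubicMoment) :
    Summit.QuantumFields.YangMills.Theses.FradkinShenkerFlow.FiniteSusceptibilityWeakCoupling := by
  intro G _ _ _ _ _ _ hG r
  obtain ⟨β₀, hβ₀⟩ := h₅ G hG r
  refine ⟨max β₀ 0, fun β hβ => ?_⟩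
  have h0 : (0 : ℝ) ≤ β := le_trans (le_max_right _ _) hβ
  have h1 : β₀ ≤ β := le_trans (le_max_left _ _) hβ
  exact susceptibility_of_domination_and_moments r β (h₂c (h₂b (h₂a h₁)) G r β h0) h₃
    (h₄ G r β (hβ₀ β h1))

/-- **The skeleton theorem (A12 shape): the crux decl BY NAME, no hypotheses, `sorry` entering only through the
seven registered `stub_*`.** Once every stub is proved this file, sorry-free, is the crux proof. -/
theorem FiniteSusceptibilityWeakCoupling_of :
    Summit.QuantumFields.YangMills.Theses.FradkinShenkerFlow.FiniteSusceptibilityWeakCoupling :=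
  finiteSusceptibilityWeakCoupling_of_stubs stub_oddTorusRP stub_rpCauchySchwarz stub_mirrorDominationAxis0
    stub_mirrorReduction stub_shellSummation stub_axisIsotropy stub_axialCubicMoment

/-! ## §5 The sibling attachment (PROVED): exponential time clustering ⇒ STUB 5

`TimeClustering` is, verbatim, the antecedent of this route's `ClusteringToYangMills` (item 9443) and the
consequent shape of `PoincareToClustering` (9444); the sibling lattice-gap legs
(`EquipartitionCriticality.LatticeGapLargeBeta` 8761, `ConvexGribovBody.UniformLatticeGap` 8778,
`ModularSelfDualFold.WeakCouplingLatticeGap` 8901, `RandomConstraintAnnealing` 8715, `FluxBootstrap` 8950/8953) are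
typed with the same correlator `latticeConnectedCorr r.ρ β (2S+1) A.F B.F n`, `n ≤ S`, some with a threshold
`S ≥ S₀(A, B)` — the form `TimeClusteringEventually` below, which is what we prove from. So every such leg gives
STUB 5, hence (with STUBS 1–4) the crux: the "g15-10 / g41-7" implications become kernel-checked. -/

/-- Volume-uniform exponential clustering in Euclidean time at weak coupling (the shape of route item 9443's
antecedent). -/
def TimeClustering : Prop :=
  ∀ (G : Type) [Group G] [TopologicalSpace G] [IsTopologicalGroup G] [CompactSpace G]
    [MeasurableSpace G] [BorelSpace G], IsCompactSimpleLieGroup G → ∀ (r : LatticeRep G),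
    ∃ β₁ : ℝ, ∀ β : ℝ, β₁ ≤ β → ∃ m : ℝ, 0 < m ∧ ∀ A B : YMSpecies G, ∃ C : ℝ, ∀ S n : ℕ, n ≤ S →
      |latticeConnectedCorr r.ρ β (2 * S + 1) A.F B.F n| ≤ C * Real.exp (-(m * n))

/-- The same with a pair-dependent volume threshold `S₀` (the shape of the sibling legs 8761/8778/…). -/
def TimeClusteringEventually : Prop :=
  ∀ (G : Type) [Group G] [TopologicalSpace G] [IsTopologicalGroup G] [CompactSpace G]
    [MeasurableSpace G] [BorelSpace G], IsCompactSimpleLieGroup G → ∀ (r : LatticeRep G),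
    ∃ β₁ : ℝ, ∀ β : ℝ, β₁ ≤ β → ∃ m : ℝ, 0 < m ∧ ∀ A B : YMSpecies G, ∃ (C : ℝ) (S₀ : ℕ),
      ∀ S : ℕ, S₀ ≤ S → ∀ n : ℕ, n ≤ S →
        |latticeConnectedCorr r.ρ β (2 * S + 1) A.F B.F n| ≤ C * Real.exp (-(m * n))

theorem timeClusteringEventually_of_timeClustering (h : TimeClustering) : TimeClusteringEventually := by
  intro G _ _ _ _ _ _ hG r
  obtain ⟨β₁, hβ₁⟩ := h G hG r
  refine ⟨β₁, fun β hβ => ?_⟩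
  obtain ⟨m, hm, hAB⟩ := hβ₁ β hβ
  refine ⟨m, hm, fun A B => ?_⟩
  obtain ⟨C, hC⟩ := hAB A B
  exact ⟨C, 0, fun S _ n hn => hC S n hn⟩

section Attachment

variable {G : Type} [Group G] [TopologicalSpace G] [IsTopologicalGroup G] [CompactSpace G]
  [MeasurableSpace G] [BorelSpace G]

/-- The crux's axis covariance IS the tree's connected time-correlator `latticeConnectedCorr` (bounded
measurable integrands under a probability measure; the shifted mean equals the unshifted one by translation
invariance of the torus state). -/
theorem covariance_eq_latticeConnectedCorr (r : LatticeRep G) (β : ℝ) (A B : YMSpecies G) (S n : ℕ) :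
    cov[fun U => A.F (torusLift (2 * S + 1) U),
        fun U => B.F (configShift (-(Pi.single 0 (n : ℤ))) (torusLift (2 * S + 1) U));
        wilsonMeasure (d := 4) (L := 2 * S + 1) r.ρ β] =
      latticeConnectedCorr r.ρ β (2 * S + 1) A.F B.F n := by
  haveI : IsProbabilityMeasure (wilsonMeasure (d := 4) (L := 2 * S + 1) r.ρ β) :=
    isProbabilityMeasure_wilsonMeasure _ r.continuous β
  obtain ⟨a, ha⟩ := A.bounded
  obtain ⟨b, hb⟩ := B.bounded
  have hmA : Measurable fun U : GaugeConfig 4 (2 * S + 1) G => A.F (torusLift (2 * S + 1) U) :=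
    A.measurable.comp (measurable_torusLift _)
  have hmB : Measurable fun U : GaugeConfig 4 (2 * S + 1) G =>
      B.F (configShift (-(Pi.single 0 (n : ℤ))) (torusLift (2 * S + 1) U)) :=
    B.measurable.comp ((configShift _).measurable.comp (measurable_torusLift _))
  have l₁ : MemLp (fun U : GaugeConfig 4 (2 * S + 1) G => A.F (torusLift (2 * S + 1) U)) 2
      (wilsonMeasure (d := 4) (L := 2 * S + 1) r.ρ β) :=
    MemLp.of_bound hmA.aestronglyMeasurable a (ae_of_all _ fun U => by
      simpa [Real.norm_eq_abs] using ha _)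
  have l₂ : MemLp (fun U : GaugeConfig 4 (2 * S + 1) G =>
      B.F (configShift (-(Pi.single 0 (n : ℤ))) (torusLift (2 * S + 1) U))) 2
      (wilsonMeasure (d := 4) (L := 2 * S + 1) r.ρ β) :=
    MemLp.of_bound hmB.aestronglyMeasurable b (ae_of_all _ fun U => by
      simpa [Real.norm_eq_abs] using hb _)
  rw [covariance_eq_sub l₁ l₂]
  -- the shifted mean is the unshifted mean (translation invariance of the torus state)
  have hmean : ∫ U, B.F (configShift (-(Pi.single 0 (n : ℤ))) (torusLift (2 * S + 1) U))
        ∂(wilsonMeasure (d := 4) (L := 2 * S + 1) r.ρ β) =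
      ∫ U, B.F (torusLift (2 * S + 1) U) ∂(wilsonMeasure (d := 4) (L := 2 * S + 1) r.ρ β) := by
    have h1 := toTorusObservable_comp_configShift (G := G) (2 * S + 1) (-(Pi.single 0 (n : ℤ))) B.F
    have h2 := wilsonExpectation_comp_torusConfigShift (d := 4) (L := 2 * S + 1) r.ρ β
      (Literature.Probability.LatticeModels.Torus.proj (2 * S + 1) (-(Pi.single 0 (n : ℤ))))
      (toTorusObservable (2 * S + 1) B.F)
    rw [← h1] at h2
    simpa [wilsonExpectation, toTorusObservable, Function.comp] using h2
  unfold latticeConnectedCorr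
  simp only [Pi.mul_apply]
  rw [hmean]

/-- Cubic moments of an exponentially decaying sequence are summable: `Σ (n+1)³ e^{-mn} < ∞` for `m > 0`. -/
theorem summable_cube_mul_exp {m : ℝ} (hm : 0 < m) :
    Summable fun n : ℕ => ((n : ℝ) + 1) ^ 3 * Real.exp (-(m * n)) := by
  have hs : ∀ k : ℕ, Summable fun n : ℕ => (n : ℝ) ^ k * Real.exp (-(m * n)) := fun k => by
    simpa [neg_mul] using Real.summable_pow_mul_exp_neg_nat_mul k hm
  have heq : (fun n : ℕ => ((n : ℝ) + 1) ^ 3 * Real.exp (-(m * n))) = fun n : ℕ =>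
      (n : ℝ) ^ 3 * Real.exp (-(m * n)) + 3 * ((n : ℝ) ^ 2 * Real.exp (-(m * n))) +
        3 * ((n : ℝ) ^ 1 * Real.exp (-(m * n))) + (n : ℝ) ^ 0 * Real.exp (-(m * n)) := by
    funext n; ring
  rw [heq]
  exact (((hs 3).add ((hs 2).mul_left 3)).add ((hs 1).mul_left 3)).add (hs 0)

/-- **Sibling attachment.** Exponential time clustering beyond a pair-dependent volume threshold implies the
transfer target `C⁺` (STUB 5): `Σ_{n ≤ S} (n+1)³ C e^{-mn} ≤ |C| Σ_n (n+1)³ e^{-mn}`, and the finitely many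
tori `S < S₀` are absorbed by `|Cov| ≤ 4‖A‖∞‖B‖∞` (`Negative.abs_covariance_le_of_abs_le`). -/
theorem axialCubicMoment_of_timeClusteringEventually (h : TimeClusteringEventually) : AxialCubicMoment := by
  intro G _ _ _ _ _ _ hG r
  obtain ⟨β₁, hβ₁⟩ := h G hG r
  refine ⟨β₁, fun β hβ A B => ?_⟩
  obtain ⟨m, hm, hAB⟩ := hβ₁ β hβ
  obtain ⟨C, S₀, hC⟩ := hAB A B
  obtain ⟨a, ha⟩ := A.bounded
  obtain ⟨b, hb⟩ := B.bounded
  have hab : 0 ≤ 4 * a * b := by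
    have ha0 : 0 ≤ a := (abs_nonneg _).trans (ha fun _ => 1)
    have hb0 : 0 ≤ b := (abs_nonneg _).trans (hb fun _ => 1)
    positivity
  set T : ℝ := ∑' n : ℕ, ((n : ℝ) + 1) ^ 3 * Real.exp (-(m * n)) with hT
  have hTs := summable_cube_mul_exp hm
  have hT0 : 0 ≤ T := tsum_nonneg fun n => by positivity
  refine ⟨|C| * T + (S₀ : ℝ) ^ 4 * (4 * a * b), fun S => ?_⟩
  haveI : IsProbabilityMeasure (wilsonMeasure (d := 4) (L := 2 * S + 1) r.ρ β) :=
    isProbabilityMeasure_wilsonMeasure _ r.continuous β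
  by_cases hS : S₀ ≤ S
  · -- large tori: termwise clustering bound, then the tail sum
    calc ∑ n ∈ Finset.range (S + 1), ((n : ℝ) + 1) ^ 3 *
            |cov[fun U => A.F (torusLift (2 * S + 1) U),
                fun U => B.F (configShift (-(Pi.single 0 (n : ℤ))) (torusLift (2 * S + 1) U));
                wilsonMeasure (d := 4) (L := 2 * S + 1) r.ρ β]|
          ≤ ∑ n ∈ Finset.range (S + 1), |C| * (((n : ℝ) + 1) ^ 3 * Real.exp (-(m * n))) := by
            refine Finset.sum_le_sum fun n hn => ?_
            have hn' : n ≤ S := Nat.lt_succ_iff.mp (Finset.mem_range.mp hn)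
            have h1 := hC S hS n hn'
            rw [← covariance_eq_latticeConnectedCorr r β A B S n] at h1
            have h2 : C * Real.exp (-(m * n)) ≤ |C| * Real.exp (-(m * n)) :=
              mul_le_mul_of_nonneg_right (le_abs_self C) (Real.exp_nonneg _)
            calc ((n : ℝ) + 1) ^ 3 * |cov[fun U => A.F (torusLift (2 * S + 1) U),
                    fun U => B.F (configShift (-(Pi.single 0 (n : ℤ))) (torusLift (2 * S + 1) U));
                    wilsonMeasure (d := 4) (L := 2 * S + 1) r.ρ β]|
                ≤ ((n : ℝ) + 1) ^ 3 * (|C| * Real.exp (-(m * n))) :=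
                  mul_le_mul_of_nonneg_left (h1.trans h2) (by positivity)
              _ = |C| * (((n : ℝ) + 1) ^ 3 * Real.exp (-(m * n))) := by ring
      _ = |C| * ∑ n ∈ Finset.range (S + 1), ((n : ℝ) + 1) ^ 3 * Real.exp (-(m * n)) := by
            rw [Finset.mul_sum]
      _ ≤ |C| * T := by
            refine mul_le_mul_of_nonneg_left ?_ (abs_nonneg C)
            exact hTs.sum_le_tsum _ fun n _ => by positivity
      _ ≤ |C| * T + (S₀ : ℝ) ^ 4 * (4 * a * b) := le_add_of_nonneg_right (by positivity)
  · -- small tori: finitely many, each term bounded by `S₀³ · 4ab`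
    push Not at hS
    calc ∑ n ∈ Finset.range (S + 1), ((n : ℝ) + 1) ^ 3 *
            |cov[fun U => A.F (torusLift (2 * S + 1) U),
                fun U => B.F (configShift (-(Pi.single 0 (n : ℤ))) (torusLift (2 * S + 1) U));
                wilsonMeasure (d := 4) (L := 2 * S + 1) r.ρ β]|
          ≤ ∑ _n ∈ Finset.range (S + 1), (S₀ : ℝ) ^ 3 * (4 * a * b) := by
            refine Finset.sum_le_sum fun n hn => ?_
            have hn' : n ≤ S := Nat.lt_succ_iff.mp (Finset.mem_range.mp hn)
            have hnS : (n : ℝ) + 1 ≤ S₀ := by exact_mod_cast (show n + 1 ≤ S₀ by omega)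
            have hcov : |cov[fun U => A.F (torusLift (2 * S + 1) U),
                fun U => B.F (configShift (-(Pi.single 0 (n : ℤ))) (torusLift (2 * S + 1) U));
                wilsonMeasure (d := 4) (L := 2 * S + 1) r.ρ β]| ≤ 4 * a * b :=
              Summit.QuantumFields.YangMills.Theorems.FiniteSusceptibilityWeakCoupling.Negative.abs_covariance_le_of_abs_le
                (fun U => ha _) (fun U => hb _)
            exact mul_le_mul (pow_le_pow_left₀ (by positivity) hnS 3) hcov (abs_nonneg _) (by positivity)
      _ = ((S + 1 : ℕ) : ℝ) * ((S₀ : ℝ) ^ 3 * (4 * a * b)) := by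
            rw [Finset.sum_const, Finset.card_range, nsmul_eq_mul]
      _ ≤ (S₀ : ℝ) * ((S₀ : ℝ) ^ 3 * (4 * a * b)) := by
            refine mul_le_mul_of_nonneg_right ?_ (by positivity)
            exact_mod_cast (show S + 1 ≤ S₀ by omega)
      _ = (S₀ : ℝ) ^ 4 * (4 * a * b) := by ring
      _ ≤ |C| * T + (S₀ : ℝ) ^ 4 * (4 * a * b) := le_add_of_nonneg_left (by positivity)

/-- Exponential time clustering (route-item shape) implies STUB 5. -/
theorem axialCubicMoment_of_timeClustering (h : TimeClustering) : AxialCubicMoment :=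
  axialCubicMoment_of_timeClusteringEventually (timeClusteringEventually_of_timeClustering h)

end Attachment

end Summit.QuantumFields.YangMills.Cruxes.FiniteSusceptibilityWeakCoupling.SupAxisReflectionTransfer

end
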